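import Literature.MathematicalPhysics.QuantumFieldTheory.Balaban1983to89.B9SectCDiffCutModelToy8

/-!
# `Balaban1983to89.B9SectCDiffCutModelToy9` — CLASS MEMBERSHIP AT MASS `a/B`: the sequence-1 factors of the one-level
toy (`G′`, `G₀ = ½(∂∂* + m²)⁻¹`, `∂G′`, `G′∂*`, and the Woodbury-assembled datum `G = Gtoy` of Toy8) in the classes
`𝒟(0, k, c)` of the cut model's `MOne` slots on the toy frame, with constants free of `B`, `n`, `N` — via the
general-mass GRADIENT DECAY of the Helmholtz kernel and Toy6's weighted-row-norm algebra at a FIXED block weight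
(no rate loss) (census `b2b-balaban-r1/SectC-inst-census.md` §6 (a⁵) ff.; notes N13–N15)

B9 = T. Bałaban, *Propagators for lattice gauge theories in a background field*, Commun. Math. Phys. **99**, 389–434
(1985) [Balaban1985BackgroundPropagators].

CITATION HEADER (lean-in-tree rule 2026-08-18).  Cell `pub-balaban`, unit `b2b-balaban-r1-g17` (READER GROUP A,
lineage r1, gen 17), journal claim `SECTC-DIFF-CUTMODEL-TOY9` (third leaf of the seat, after `…Toy7` / `…Toy8` under
claims `SECTC-DIFF-CUTMODEL-TOY7` / `…-TOY8`).  Source: doi:10.1007/bf01240355, held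
`paper:balaban1985-cmp99-background-propagators`, journal page = PDF page + 388.  This unit re-read NO page and
introduces NO quotation: the only printed shapes inhabited here are the target shapes of three sequence-1 slots of
`MOne` of `…B9SectCDiffAssembly` — `mG : OpDec F bb bb p p 0 2 c G`, `mDG' : OpDec F bb bs p p 0 1 c (D * G')`,
`mG' : OpDec F bs bs p p 0 2 c G'` — which carry the scale powers of B9's Theorem 3.2 (3.48), p. 398 [PDF 10]
(sentence quoted VERBATIM in the header of `…B9SectCDiffAssembly`; the classes `𝒟(n, k, c)` transcribe Theorem 3.1
(3.42), p. 397 [PDF 9], quoted in the header of `…B9SectCDiffEstimate`); the present declarations point to those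
quotations BY NAME only.  Tree inputs (by name): `B9SectCDiffEstimate.{Frame, Frame.rate_zero, OpDec, WDec.mono}`,
`B9SectCDiffCutModelToy.{bdist, bdist_nonneg, bdist_isPseudoDist, Qp}`, `B9SectCDiffCutModelToy2.Qpt`,
`B9SectCDiffCutModelToy3.{toyFrame, toyFrame_ρ, toyFrame_sc, toyFrame_δ₀}`, `B9SectCDiffCutModelToy4.{ι, Dfw, Dbw,
Dbw_eq_transpose}`, `B9SectCDiffCutModelToy5.{Gr, Gr_nonneg, Gr_transpose, U, DGr_apply, W_nonneg, D_nonneg,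
absW_le_one, W_tele, D_tele, U_le}`, `B9SectCDiffCutModelToy6.{Gd, Gd_nonneg, Gd_mass_le, IsWt, IsWt.nonneg, RowLe,
RowLe.mul, ewt, isWt_ewt}`, `B9SectCDiffCutModelToy7.{R1, R1_pos, R1_num_le, weighted_rowsum_le, kernel_weight_le,
sum_line_exp_le, one_sub_exp_neg_pos, inv_one_sub_exp_le, exp_half_le, srate_eq, rowLe_mono}`,
`B9SectCDiffCutModelToy8.{MC, G0, Gtoy, isUnit_MC_num}`; Mathlib otherwise.  Cell rows: GAPS C-r1g13-1 (the cut
model), C-r1g14-1 … C-r1g17-3 (the toys 1–8), this module's row C-r1g17-4; census §6 (a⁵) / notes N10–N15.  No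
`HarnessLib` fact, no named-fact `Prop`, no `instance`, no new predicate (Toy6's `IsWt` / `RowLe` are PROVED here for
the block weight on sites and for the five factors); no `sorry`.

## WHAT THIS MODULE DOES

Toy7/Toy8 (this seat's first two leaves) inverted the two COARSE operators of the toy's sequence datum (`E₂⁻¹ ∈
𝒟(0, −4, 3a⁴)`, `M_C⁻¹ ∈ 𝒟(0, −4, 6a⁴)`, the `mC` shape) and exhibited the datum in closed Woodbury form
`Gtoy = G₀ + G₀(∂G′Q′ᵗ)M_C⁻¹(Q′G′∂*)G₀` satisfying the `TwoSeq.hG₁` equation with `∂ ≠ 0` — but NOT its membership in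
the class `𝒟(0, 2, c)` of the slot `mG`, nor the FINE factors at mass `a/B` (Toy5/Toy6's `Gr_opDec`, `DGr_opDec`,
`Gd_opDec` are the mass-`1/B` case, whose constants are not absolute at `k = 2`).  Two obstacles and their removal:
(1) the product calculus `OpDec.fmul` of `…B9SectCDiffEstimate` maps `𝒟(0,k₁,c₁)·𝒟(n,k₂,c₂) → 𝒟(n+2, k₁+k₂,
c₁c₂ΛK(u))` — a RATE LOSS per factor and the volume factor `K(u) = n(B+1)` of the toy frame — so it cannot reach the
`n = 0` slot with an absolute constant; instead all five square fine factors of `Gtoy` (with the coarse inverse LIFTED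
to sites, `Q′ᵗM_C⁻¹Q′`) are normed in Toy6's weighted row norm `RowLe (siteWt κ)` at ONE block weight
`siteWt κ (x,y) = e^{κ|blk x − blk y|}`, where products MULTIPLY norms with no loss (`RowLe.mul`), and a weighted row
bound is converted into the class ONCE at the end (`opDec_fine_of_rowLe`, the fine analogue of Toy6's
`opDec_coarse_of_rowLe`); (2) the slot `mDG'` has `k = 1`, so the gradient kernel needs a bound WITHOUT the factor
`4/m = 4B/a` of `Gr_mass_le`: the general-mass gradient decay `|∂G′(x,y)| ≤ 8e^{1/4}e^{−(m/4)|ι x − ι y|}` (§1; Toy5's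
`absW_le` is the case `m = 1/B`), proved from Toy5's monotone-column structure (`W_tele`, `D_tele`, `U_le`,
`absW_le_one`) by telescoping over a window of half the distance.

* §1 GRADIENT DECAY AT GENERAL MASS `0 < m ≤ 1` for the column `U(i) = G′(m²)(site i, y)`: `one_le_grad_profile`
  (the regime `m·d ≤ 1`), `window_bound`, the flanks **`W_mass_le`** (`i < ι y`: `U(i+1) − U(i) ≤
  8e^{1/4}e^{−(m/4)(ι y − i)}` once `m(ι y − i) > 1`) and **`D_mass_le`** (`ι y ≤ i`), hence **`absW_mass_le :
  |U(i+1) − U(i)| ≤ 8e^{1/4}·e^{−(m/4)|i − ι y|}`** and the kernel entries **`DGr_mass_entry_le`** /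
  **`GrD_mass_entry_le`** (`G′∂* = (∂G′)ᵀ`, `GrD_eq_transpose`);
* §2 WEIGHTED ROW NORMS at the block weight `siteWt n B κ` (`siteWt_apply`, `isWt_siteWt`): the generic
  `weighted_rowsum_of_profile` (`|K(x,z)| ≤ Ce^{−r|Δι|}`, `r > κ/B` ⇒ `Σ_z |K(x,z)|w(x,z) ≤ Ce^{κ}(1+e^{−(r−κ/B)})(1 −
  e^{−(r−κ/B)})⁻¹`, Toy7's `kernel_weight_le` + `sum_line_exp_le`), and the factor norms **`rowLe_Gr`** /
  **`rowLe_Gd`** (`≤ R₁(m)`, Toy7's constant), **`rowLe_G0`** (`≤ R₁/2`), **`rowLe_DGr`** / **`rowLe_GrD`** (`≤ R_D(m) :=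
  8e^{1/4}e^{κ}(1+e^{−s′})(1−e^{−s′})⁻¹`, `s′ = m/4 − κ/B`; `RD`, `RD_nonneg`);
* §3 THE ALGEBRA: `rowLe_add`, `rowLe_smul`, `rowLe_nonneg`; the fine packaging **`opDec_fine_of_rowLe`** (`RowLe
  (siteWt κ) T R`, `0 ≤ κ`, `δ₀ ≤ κ`, `R ≤ cB^k` ⇒ `T ∈ 𝒟(0, k, c)` on `toyFrame`, block majorant `max R 0·e^{−κ|I−J|}`);
  the coarse lift `coarseLift_apply : (Q′ᵗMQ′)(x,y) = M(blk x, blk y)/B` and **`rowLe_coarseLift`** (`RowLe (ewt κ) M R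
  ⇒ RowLe (siteWt κ) (Q′ᵗMQ′) R`);
* §4 `Gtoy_eq_prod` (re-association into five square fine factors) and the symbolic norm **`rowLe_Gtoy : N(Gtoy(m²,
  l²)) ≤ R₁(l)/2 + (R₁(l)/2)·R_D(m)·R_M·R_D(m)·(R₁(l)/2)`** given `RowLe (ewt κ) M_C⁻¹ R_M`;
* §5 NUMBERS at `κ = 1/2`, `m = l = a/B` (`exp_fourth_le`, `qrate_eq`, `geomfac_q_le`, **`RD_num_le : R_D ≤
  224B/(a−2)`** for `2 < a ≤ B`): the slot shapes **`Gr_opDec_num : G′((a/B)²) ∈ 𝒟(0, 2, 40/(a(a−1)))`**,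
  **`G0_opDec_num : G₀ ∈ 𝒟(0, 2, 20/(a(a−1)))`** (`1 < a ≤ B`), **`DGr_opDec_num : ∂G′ ∈ 𝒟(0, 1, 224/(a−2))`**,
  **`GrD_opDec_num`** (`2 < a ≤ B`), and — with Toy8's `isUnit_MC_num` (`R_M = 4a⁶/(B⁴(a−6)²)`), the crude sizes
  `factor_sizes` (`R₁/2 ≤ 40B²/a²`, `R_D ≤ 448B/a`, `R_M ≤ 16a⁴/B⁴`) and the B-power bookkeeping `2 + 1 − 4 + 1 + 2 =
  2` — **`rowLe_Gtoy_num : N(Gtoy) ≤ 10¹⁰B²/a²`** and **`Gtoy_opDec_num : Gtoy((a/B)², (a/B)²) ∈ 𝒟(0, 2, 10¹⁰/a²)`**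
  on `toyFrame n B N hN δ₀` for `2²⁰ ≤ a ≤ B`, `δ₀ ≤ 1/2` (`40 + 40·448·16·448·40 = 5 138 022 440 ≤ 10¹⁰`);
* §6 `opDec_toy_mono`: on the toy frame the class constant may be enlarged (`0 ≤ c ≤ c′`), so the per-slot constants
  of Toy7/Toy8 and of §5 can be replaced by their maximum when one `c` is wanted (`MOne`).

## WHAT IS NOT CLAIMED (ABSOLUTE RULE)

Nothing printed is asserted.  Everything here is finite sums of exponentials, finite-dimensional linear algebra and the
one-dimensional discrete Helmholtz kernel structure of Toy5 (folklore); B9's Theorems 3.1–3.3 concern gauge-covariant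
operators in a background field on a four-dimensional multi-level lattice, and nothing here bears on them or on their
printed proofs — the norm algebra is the GENERIC weighted-`ℓ^∞` one, not B9's (3.47)–(3.61).  HONEST CAVEATS: (1) the
constants `8e^{1/4}`, rate `m/4`, `224`, `10¹⁰` and the threshold `a ≥ 2²⁰` (inherited from Toy8's `isUnit_MC_num`)
are artefacts of crude inputs (`4/m`, rate `m/2` of `Gr_mass_le`; halving the rate in the window argument; the sizes
`factor_sizes`); no optimisation was attempted and nothing downstream needs small constants; (2) the slots `mQ`,
`mQ't`, `mQ'` (Toy2/Toy3, mass-free) and `mC` (Toy7 `E2_inv_opDec_num` / Toy8 `MC_inv_opDec_num`, coarse) are NOT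
re-proved here, and the PACKAGING of all slots with Toy4's Leibniz block and gen 15's Q-records into a `TwoSeq` /
`CutModel` / `EstHyp` instance with `∂ ≠ 0` (one common constant via §6, the `(L)` bundle, the zone classes), an
`n`-free majorant profile, and the `b = 0` reading of the Leibniz block are NOT done (census §6 (a⁵) ff., note N15).
Value = kernel certificate that every sequence-1 FINE factor of the toy's datum, including the Woodbury-assembled `G`
with `∂ ≠ 0`, sits in the class its `MOne` slot demands with absolute constants — NOT summit progress.
-/

namespace Literature.MathematicalPhysics.QuantumFieldTheory.Balaban1983to89.B9SectCDiffCutModelToy9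

open Finset Real
open B9SectCDiffEstimate
open B9SectCDiffCutModel
open B9SectCDiffCutModelToy
open B9SectCDiffCutModelToy2
open B9SectCDiffCutModelToy3
open B9SectCDiffCutModelToy4
open B9SectCDiffCutModelToy5
open B9SectCDiffCutModelToy6
open B9SectCDiffCutModelToy7
open B9SectCDiffCutModelToy8

noncomputable section

/-! ## §1 Gradient decay of the Helmholtz kernel at general mass -/

section Gradient

variable {n B : ℕ} {m : ℝ} {y : Fin n × Fin B}

/-- the trivial regime `m·d ≤ 1`: `1 ≤ 8e^{1/4}e^{−(m/4)d}`. [folklore] -/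
theorem one_le_grad_profile {d : ℝ} (hd : m * d ≤ 1) :
    (1 : ℝ) ≤ 8 * Real.exp (1 / 4) * Real.exp (-(m / 4 * d)) := by
  have h1 : (1 : ℝ) ≤ Real.exp (1 / 4) * Real.exp (-(m / 4 * d)) := by
    rw [← Real.exp_add]
    exact Real.one_le_exp (by linarith)
  have h2 : 0 ≤ Real.exp (1 / 4) * Real.exp (-(m / 4 * d)) := by positivity
  linarith

/-- the window arithmetic: `U_far/(k+1) ≤ 8·profile` when `k + 1 ≥ d/2`, `m·d > 1`. [folklore] -/
theorem window_bound (hm0 : 0 < m) {d k P : ℝ} (hP : 0 ≤ P) (hk : d ≤ 2 * (k + 1))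
    (hmd : 1 < m * d) : 4 / m * P / (k + 1) ≤ 8 * P := by
  have hd : 0 < d := by nlinarith
  have hkpos : 0 < k + 1 := by linarith
  calc 4 / m * P / (k + 1) ≤ 4 / m * P / (d / 2) :=
        div_le_div_of_nonneg_left (by positivity) (by positivity) (by linarith)
    _ = 8 / (m * d) * P := by field_simp; ring
    _ ≤ 8 * P := by
        refine mul_le_mul_of_nonneg_right ?_ hP
        rw [div_le_iff₀ (by positivity)]; nlinarith

/-- LEFT FLANK at general mass: for `i < ι y` with `m(ι y − i) > 1`,
`W(i) ≤ 8e^{1/4}e^{−(m/4)(ι y − i)}` (telescoping over a window of half the distance + the decay of `U`).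
[folklore] -/
theorem W_mass_le (hm0 : 0 < m) (hm1 : m ≤ 1) {i : ℕ} (hi : i < ι y)
    (hfar : 1 < m * ((ι y : ℝ) - i)) :
    U n B (m ^ 2) y (i + 1) - U n B (m ^ 2) y i
      ≤ 8 * Real.exp (1 / 4) * Real.exp (-(m / 4 * ((ι y : ℝ) - i))) := by
  have hμ : 0 < m ^ 2 := by positivity
  obtain ⟨d, hd⟩ := Nat.exists_eq_add_of_le hi.le
  have hd1 : 1 ≤ d := by omega
  have hyR : ((ι y : ℝ) - i) = (d : ℝ) := by rw [hd]; push_cast; ring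
  rw [hyR] at hfar ⊢
  -- the window `k = ⌊(d−1)/2⌋`
  obtain ⟨k, hk1, hk2⟩ : ∃ k : ℕ, 2 * k ≤ d - 1 ∧ d ≤ 2 * k + 2 := ⟨(d - 1) / 2, by omega, by omega⟩
  have hik : i + k < ι y := by omega
  have hk1R : 2 * (k : ℝ) ≤ (d : ℝ) - 1 := by
    have : ((2 * k : ℕ) : ℝ) ≤ ((d - 1 : ℕ) : ℝ) := by exact_mod_cast hk1
    rw [Nat.cast_sub hd1] at this; push_cast at this; linarith
  have hk2R : (d : ℝ) ≤ 2 * ((k : ℝ) + 1) := by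
    have : ((d : ℕ) : ℝ) ≤ ((2 * k + 2 : ℕ) : ℝ) := by exact_mod_cast hk2
    push_cast at this; linarith
  have hkpos : (0 : ℝ) < (k : ℝ) + 1 := by positivity
  -- telescoping and the decay of `U` at the far end of the window
  have htel := W_tele (n := n) (B := B) (μ := m ^ 2) (y := y) hμ hik
  have hU := U_le (n := n) (B := B) (y := y) hm0 hm1 (i + k + 1)
  have hdist : |((i + k + 1 : ℕ) : ℝ) - ι y| = (d : ℝ) - k - 1 := by
    rw [hd]; push_cast
    rw [abs_of_nonpos (by linarith)]; ring
  rw [hdist] at hU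
  have hexp : Real.exp (-(m / 2 * ((d : ℝ) - k - 1))) ≤ Real.exp (1 / 4) * Real.exp (-(m / 4 * (d : ℝ))) := by
    rw [← Real.exp_add]
    exact Real.exp_le_exp.mpr (by nlinarith)
  set P := Real.exp (1 / 4) * Real.exp (-(m / 4 * (d : ℝ))) with hP
  have hW : U n B (m ^ 2) y (i + 1) - U n B (m ^ 2) y i ≤ 4 / m * P / ((k : ℝ) + 1) := by
    rw [le_div_iff₀ hkpos]
    calc (U n B (m ^ 2) y (i + 1) - U n B (m ^ 2) y i) * ((k : ℝ) + 1)
        = ((k : ℝ) + 1) * (U n B (m ^ 2) y (i + 1) - U n B (m ^ 2) y i) := by ring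
      _ ≤ U n B (m ^ 2) y (i + k + 1) := htel
      _ ≤ 4 / m * Real.exp (-(m / 2 * ((d : ℝ) - k - 1))) := hU
      _ ≤ 4 / m * P := mul_le_mul_of_nonneg_left hexp (by positivity)
  calc U n B (m ^ 2) y (i + 1) - U n B (m ^ 2) y i ≤ 4 / m * P / ((k : ℝ) + 1) := hW
    _ ≤ 8 * P := window_bound hm0 (by positivity) hk2R hfar
    _ = _ := by rw [hP]; ring

/-- RIGHT FLANK at general mass: for `ι y ≤ i` with `m(i − ι y) > 1`,
`D(i) = U(i) − U(i+1) ≤ 8e^{1/4}e^{−(m/4)(i − ι y)}`. [folklore] -/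
theorem D_mass_le (hm0 : 0 < m) (hm1 : m ≤ 1) {i : ℕ} (hi : ι y ≤ i)
    (hfar : 1 < m * ((i : ℝ) - ι y)) :
    U n B (m ^ 2) y i - U n B (m ^ 2) y (i + 1)
      ≤ 8 * Real.exp (1 / 4) * Real.exp (-(m / 4 * ((i : ℝ) - ι y))) := by
  have hμ : 0 < m ^ 2 := by positivity
  obtain ⟨d, hd⟩ := Nat.exists_eq_add_of_le hi
  have hyR : ((i : ℝ) - ι y) = (d : ℝ) := by rw [hd]; push_cast; ring
  rw [hyR] at hfar ⊢
  -- the window `k = ⌊d/2⌋`, base point `a₀ = i − k ≥ ι y`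
  obtain ⟨k, hk1, hk2⟩ : ∃ k : ℕ, 2 * k ≤ d ∧ d ≤ 2 * k + 1 := ⟨d / 2, by omega, by omega⟩
  have ha0 : ι y ≤ i - k := by omega
  have hik : i - k + k = i := by omega
  have hk2R : (d : ℝ) ≤ 2 * ((k : ℝ) + 1) := by
    have : ((d : ℕ) : ℝ) ≤ ((2 * k + 1 : ℕ) : ℝ) := by exact_mod_cast hk2
    push_cast at this; linarith
  have hk1R : 2 * (k : ℝ) ≤ (d : ℝ) := by
    have : ((2 * k : ℕ) : ℝ) ≤ ((d : ℕ) : ℝ) := by exact_mod_cast hk1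
    push_cast at this; linarith
  have hkpos : (0 : ℝ) < (k : ℝ) + 1 := by positivity
  have htel := D_tele (n := n) (B := B) (μ := m ^ 2) (y := y) (a₀ := i - k) (k := k) hμ ha0
  rw [hik] at htel
  have hU := U_le (n := n) (B := B) (y := y) hm0 hm1 (i - k)
  have hdist : |((i - k : ℕ) : ℝ) - ι y| = (d : ℝ) - k := by
    rw [Nat.cast_sub (by omega : k ≤ i), hd]; push_cast
    rw [abs_of_nonneg (by linarith)]; ring
  rw [hdist] at hU
  have hexp : Real.exp (-(m / 2 * ((d : ℝ) - k))) ≤ Real.exp (1 / 4) * Real.exp (-(m / 4 * (d : ℝ))) := by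
    rw [← Real.exp_add]
    exact Real.exp_le_exp.mpr (by nlinarith)
  set P := Real.exp (1 / 4) * Real.exp (-(m / 4 * (d : ℝ))) with hP
  have hW : U n B (m ^ 2) y i - U n B (m ^ 2) y (i + 1) ≤ 4 / m * P / ((k : ℝ) + 1) := by
    rw [le_div_iff₀ hkpos]
    calc (U n B (m ^ 2) y i - U n B (m ^ 2) y (i + 1)) * ((k : ℝ) + 1)
        = ((k : ℝ) + 1) * (U n B (m ^ 2) y i - U n B (m ^ 2) y (i + 1)) := by ring
      _ ≤ U n B (m ^ 2) y (i - k) := htel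
      _ ≤ 4 / m * Real.exp (-(m / 2 * ((d : ℝ) - k))) := hU
      _ ≤ 4 / m * P := mul_le_mul_of_nonneg_left hexp (by positivity)
  calc U n B (m ^ 2) y i - U n B (m ^ 2) y (i + 1) ≤ 4 / m * P / ((k : ℝ) + 1) := hW
    _ ≤ 8 * P := window_bound hm0 (by positivity) hk2R hfar
    _ = _ := by rw [hP]; ring

/-- **GRADIENT DECAY AT GENERAL MASS** `0 < m ≤ 1`: `|U(i+1) − U(i)| ≤ 8e^{1/4}·e^{−(m/4)|i − ι y|}` for the column
`y` of `G′ = (∂*∂ + m²)⁻¹` — an ABSOLUTE constant (Toy5's `absW_le` is the case `m = 1/B`): in the regime `m·d ≤ 1`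
by the unit-jump bound `absW_le_one`, beyond it by telescoping over a window of length `≍ d/2 ≥ 1/(2m)`. [folklore] -/
theorem absW_mass_le (hm0 : 0 < m) (hm1 : m ≤ 1) (y : Fin n × Fin B) (i : ℕ) :
    |U n B (m ^ 2) y (i + 1) - U n B (m ^ 2) y i|
      ≤ 8 * Real.exp (1 / 4) * Real.exp (-(m / 4 * |(i : ℝ) - ι y|)) := by
  have hμ : 0 < m ^ 2 := by positivity
  by_cases hnear : m * |(i : ℝ) - ι y| ≤ 1
  · exact (absW_le_one (y := y) hμ i).trans (one_le_grad_profile hnear)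
  · rw [not_le] at hnear
    rcases Nat.lt_or_ge i (ι y) with hi | hi
    · have hi' : (i : ℝ) < ι y := by exact_mod_cast hi
      have habs : |(i : ℝ) - ι y| = (ι y : ℝ) - i := by
        rw [abs_sub_comm]; exact abs_of_pos (by linarith)
      rw [habs] at hnear ⊢
      rw [abs_of_nonneg (W_nonneg (y := y) hμ i hi)]
      exact W_mass_le hm0 hm1 hi hnear
    · have habs : |(i : ℝ) - ι y| = (i : ℝ) - ι y :=
        abs_of_nonneg (by have : (ι y : ℝ) ≤ i := by exact_mod_cast hi
                          linarith)
      rw [habs] at hnear ⊢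
      rw [abs_sub_comm, abs_of_nonneg (D_nonneg (y := y) hμ hi)]
      exact D_mass_le hm0 hm1 hi hnear

/-- the gradient kernel `∂G′` at general mass: `|(∂G′)(x,y)| ≤ 8e^{1/4}e^{−(m/4)|ι x − ι y|}`. [folklore] -/
theorem DGr_mass_entry_le (hm0 : 0 < m) (hm1 : m ≤ 1) (x y : Fin n × Fin B) :
    |(Dfw n B * Gr n B (m ^ 2)) x y| ≤ 8 * Real.exp (1 / 4) * Real.exp (-(m / 4 * |(ι x : ℝ) - ι y|)) := by
  rw [DGr_apply]; exact absW_mass_le hm0 hm1 y (ι x)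

/-- `G′∂* = (∂G′)ᵀ`. [folklore] -/
theorem GrD_eq_transpose (μ : ℝ) : Gr n B μ * Dbw n B = (Dfw n B * Gr n B μ).transpose := by
  rw [Matrix.transpose_mul, Gr_transpose, ← Dbw_eq_transpose]

/-- the adjoint gradient kernel `G′∂*` at general mass: the same bound. [folklore] -/
theorem GrD_mass_entry_le (hm0 : 0 < m) (hm1 : m ≤ 1) (x y : Fin n × Fin B) :
    |(Gr n B (m ^ 2) * Dbw n B) x y| ≤ 8 * Real.exp (1 / 4) * Real.exp (-(m / 4 * |(ι x : ℝ) - ι y|)) := by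
  rw [GrD_eq_transpose, Matrix.transpose_apply, abs_sub_comm]
  exact DGr_mass_entry_le hm0 hm1 y x

end Gradient

/-! ## §2 Weighted row norms at the block weight -/

section RowNorms

variable {n B : ℕ} {m κ : ℝ}

/-- the BLOCK WEIGHT on sites: `w(x,y) = e^{κ|blk x − blk y|}` (Toy6's `ewt` pulled back along `Prod.fst`).
OURS (typing). [folklore] -/
def siteWt (n B : ℕ) (κ : ℝ) (x y : Fin n × Fin B) : ℝ := ewt n κ x.1 y.1

/-- [folklore] -/
theorem siteWt_apply (κ : ℝ) (x y : Fin n × Fin B) : siteWt n B κ x y = Real.exp (κ * bdist n x.1 y.1) := rfl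

/-- the block weight is a weight (`≥ 1`, `= 1` on the diagonal, supermultiplicative). [folklore] -/
theorem isWt_siteWt (hκ : 0 ≤ κ) : IsWt (siteWt n B κ) where
  one_le x y := (isWt_ewt (n := n) hκ).one_le x.1 y.1
  diag x := (isWt_ewt (n := n) hκ).diag x.1
  tri x y z := (isWt_ewt (n := n) hκ).tri x.1 y.1 z.1

/-- GENERIC WEIGHTED ROW SUM from an exponential profile: `|K(x,z)| ≤ C e^{−r|Δι|}` for all `z` and
`r > κ/B` give `Σ_z |K(x,z)|·w(x,z) ≤ C e^{κ}(1 + e^{−(r−κ/B)})(1 − e^{−(r−κ/B)})⁻¹` (Toy7's `kernel_weight_le` +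
`sum_line_exp_le`). [folklore] -/
theorem weighted_rowsum_of_profile {K : Matrix (Fin n × Fin B) (Fin n × Fin B) ℝ} {C r : ℝ} (hC : 0 ≤ C)
    (hκ : 0 ≤ κ) (hB : 0 < B) (hs : 0 < r - κ / B) (x : Fin n × Fin B)
    (hK : ∀ z, |K x z| ≤ C * Real.exp (-(r * |(ι x : ℝ) - ι z|))) :
    ∑ z, |K x z| * siteWt n B κ x z
      ≤ C * Real.exp κ * ((1 + Real.exp (-(r - κ / B))) * (1 - Real.exp (-(r - κ / B)))⁻¹) := by
  have hpt : ∀ z, |K x z| * siteWt n B κ x z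
      ≤ C * Real.exp κ * Real.exp (-((r - κ / B) * |(ι x : ℝ) - ι z|)) := by
    intro z
    rw [siteWt_apply]
    calc |K x z| * Real.exp (κ * bdist n x.1 z.1)
        ≤ C * Real.exp (-(r * |(ι x : ℝ) - ι z|)) * Real.exp (κ * bdist n x.1 z.1) :=
          mul_le_mul_of_nonneg_right (hK z) (Real.exp_nonneg _)
      _ = C * (Real.exp (-(r * |(ι x : ℝ) - ι z|)) * Real.exp (κ * bdist n x.1 z.1)) := by ring
      _ ≤ C * (Real.exp κ * Real.exp (-((r - κ / B) * |(ι x : ℝ) - ι z|))) :=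
          mul_le_mul_of_nonneg_left (kernel_weight_le hκ hB r x z) hC
      _ = _ := by ring
  calc ∑ z, |K x z| * siteWt n B κ x z
      ≤ ∑ z, C * Real.exp κ * Real.exp (-((r - κ / B) * |(ι x : ℝ) - ι z|)) := sum_le_sum fun z _ => hpt z
    _ = C * Real.exp κ * ∑ z, Real.exp (-((r - κ / B) * |(ι x : ℝ) - ι z|)) := by rw [mul_sum]
    _ ≤ _ := mul_le_mul_of_nonneg_left (sum_line_exp_le hs x) (by positivity)

/-- `G′(m²)` has block-weighted row norm `≤ R₁(m)` (Toy7's `weighted_rowsum_le`). [folklore] -/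
theorem rowLe_Gr (hm0 : 0 < m) (hm1 : m ≤ 1) (hκ : 0 ≤ κ) (hB : 0 < B) (hs : 0 < m / 2 - κ / B) :
    RowLe (siteWt n B κ) (Gr n B (m ^ 2)) (R1 B m κ) := by
  intro x
  have hμ : 0 < m ^ 2 := by positivity
  have h := weighted_rowsum_le (n := n) hm0 hm1 hκ hB hs x
  unfold R1
  refine le_trans (le_of_eq (sum_congr rfl fun z _ => ?_)) h
  rw [siteWt_apply, abs_of_nonneg (Gr_nonneg hμ x z)]

/-- `G_d(m²) = (∂∂* + m²)⁻¹` has block-weighted row norm `≤ R₁(m)` (reflection: `Gd_mass_le`). [folklore] -/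
theorem rowLe_Gd (hm0 : 0 < m) (hm1 : m ≤ 1) (hκ : 0 ≤ κ) (hB : 0 < B) (hs : 0 < m / 2 - κ / B) :
    RowLe (siteWt n B κ) (Gd n B (m ^ 2)) (R1 B m κ) := by
  intro x
  have hμ : 0 < m ^ 2 := by positivity
  have h := weighted_rowsum_of_profile (K := Gd n B (m ^ 2)) (C := 4 / m) (r := m / 2) (by positivity)
    hκ hB hs x (fun z => by rw [abs_of_nonneg (Gd_nonneg hμ x z)]; exact Gd_mass_le hm0 hm1 x z)
  unfold R1
  linarith

/-- `G₀ = ½G_d(m²)` has block-weighted row norm `≤ R₁(m)/2`. [folklore] -/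
theorem rowLe_G0 (hm0 : 0 < m) (hm1 : m ≤ 1) (hκ : 0 ≤ κ) (hB : 0 < B) (hs : 0 < m / 2 - κ / B) :
    RowLe (siteWt n B κ) (G0 n B (m ^ 2)) (R1 B m κ / 2) := by
  intro x
  have h := rowLe_Gd (n := n) hm0 hm1 hκ hB hs x
  unfold G0
  have e : ∑ z, |((1 / 2 : ℝ) • Gd n B (m ^ 2)) x z| * siteWt n B κ x z
      = (1 / 2) * ∑ z, |Gd n B (m ^ 2) x z| * siteWt n B κ x z := by
    rw [mul_sum]
    refine sum_congr rfl fun z _ => ?_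
    rw [Matrix.smul_apply, smul_eq_mul, abs_mul, abs_of_pos (by norm_num : (0 : ℝ) < 1 / 2)]; ring
  rw [e]; linarith

/-- the weighted row-sum constant of the gradient kernels,
`R_D = 8e^{1/4}e^{κ}(1 + e^{−s′})(1 − e^{−s′})⁻¹`, `s′ = m/4 − κ/B`. OURS (typing). [folklore] -/
def RD (B : ℕ) (m κ : ℝ) : ℝ :=
  8 * Real.exp (1 / 4) * Real.exp κ
    * ((1 + Real.exp (-(m / 4 - κ / B))) * (1 - Real.exp (-(m / 4 - κ / B)))⁻¹)

/-- `R_D ≥ 0` for `s′ > 0`. [folklore] -/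
theorem RD_nonneg (hs : 0 < m / 4 - κ / B) : 0 ≤ RD B m κ := by
  unfold RD
  have := one_sub_exp_neg_pos hs
  positivity

/-- `∂G′(m²)` has block-weighted row norm `≤ R_D(m)` (class `k = 1` size: `R_D = O(B/m)`-free of `4/m`). [folklore] -/
theorem rowLe_DGr (hm0 : 0 < m) (hm1 : m ≤ 1) (hκ : 0 ≤ κ) (hB : 0 < B) (hs : 0 < m / 4 - κ / B) :
    RowLe (siteWt n B κ) (Dfw n B * Gr n B (m ^ 2)) (RD B m κ) := by
  intro x
  have h := weighted_rowsum_of_profile (K := Dfw n B * Gr n B (m ^ 2)) (C := 8 * Real.exp (1 / 4))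
    (r := m / 4) (by positivity) hκ hB hs x (fun z => DGr_mass_entry_le hm0 hm1 x z)
  unfold RD
  linarith

/-- `G′(m²)∂*` has block-weighted row norm `≤ R_D(m)`. [folklore] -/
theorem rowLe_GrD (hm0 : 0 < m) (hm1 : m ≤ 1) (hκ : 0 ≤ κ) (hB : 0 < B) (hs : 0 < m / 4 - κ / B) :
    RowLe (siteWt n B κ) (Gr n B (m ^ 2) * Dbw n B) (RD B m κ) := by
  intro x
  have h := weighted_rowsum_of_profile (K := Gr n B (m ^ 2) * Dbw n B) (C := 8 * Real.exp (1 / 4))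
    (r := m / 4) (by positivity) hκ hB hs x (fun z => GrD_mass_entry_le hm0 hm1 x z)
  unfold RD
  linarith

end RowNorms

/-! ## §3 The row-norm algebra: sums, scalars, the fine packaging, the coarse lift -/

section Algebra

variable {α : Type*} [Fintype α] {w : α → α → ℝ} {M N : Matrix α α ℝ} {q r : ℝ}

/-- `RowLe` is subadditive (for a weight). [folklore] -/
theorem rowLe_add (hw : IsWt w) (hM : RowLe w M q) (hN : RowLe w N r) : RowLe w (M + N) (q + r) := by
  intro i
  calc ∑ j, |(M + N) i j| * w i j ≤ ∑ j, (|M i j| * w i j + |N i j| * w i j) := by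
        refine sum_le_sum fun j _ => ?_
        rw [Matrix.add_apply, ← add_mul]
        exact mul_le_mul_of_nonneg_right (abs_add_le _ _) (hw.nonneg i j)
    _ = ∑ j, |M i j| * w i j + ∑ j, |N i j| * w i j := sum_add_distrib
    _ ≤ q + r := add_le_add (hM i) (hN i)

/-- `RowLe` is absolutely homogeneous. [folklore] -/
theorem rowLe_smul (hM : RowLe w M q) (c : ℝ) : RowLe w (c • M) (|c| * q) := by
  intro i
  have e : ∑ j, |(c • M) i j| * w i j = |c| * ∑ j, |M i j| * w i j := by
    rw [mul_sum]
    exact sum_congr rfl fun j _ => by rw [Matrix.smul_apply, smul_eq_mul, abs_mul, mul_assoc]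
  rw [e]
  exact mul_le_mul_of_nonneg_left (hM i) (abs_nonneg c)

/-- a row bound is non-negative (when there is a row). [folklore] -/
theorem rowLe_nonneg (hw : IsWt w) (hM : RowLe w M q) (i : α) : 0 ≤ q :=
  le_trans (sum_nonneg fun j _ => mul_nonneg (abs_nonneg _) (hw.nonneg i j)) (hM i)

end Algebra

section Packaging

variable {n B : ℕ} {N : Finset (Fin n)} {hN : N.Nonempty} {δ₀ κ : ℝ}

/-- **A BLOCK-WEIGHTED ROW BOUND IS THE `(M)`-CLASS OF A FINE OPERATOR** (the fine analogue of Toy6's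
`opDec_coarse_of_rowLe`): `Σ_y |T(x,y)|e^{κ|blk x − blk y|} ≤ R` for every row, `0 ≤ κ`, `δ₀ ≤ κ`, `R ≤ c·B^k` give
`T ∈ 𝒟(0, k, c)` on the toy frame with block maps `Prod.fst` — block majorant `K(I,J) = R·e^{−κ|I−J|}`, NO rate loss.
[folklore] -/
theorem opDec_fine_of_rowLe {T : Matrix (Fin n × Fin B) (Fin n × Fin B) ℝ} {R c : ℝ} {k : ℤ} (hκ0 : 0 ≤ κ)
    (hκ : δ₀ ≤ κ) (hT : RowLe (siteWt n B κ) T R) (hc : 0 ≤ c) (hR : R ≤ c * (B : ℝ) ^ k) :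
    OpDec (toyFrame n B N hN δ₀) Prod.fst Prod.fst id id 0 k c T := by
  refine ⟨fun I J => max R 0 * Real.exp (-(κ * bdist n I J)),
    ⟨fun I J => mul_nonneg (le_max_right _ _) (Real.exp_nonneg _), fun x J => ?_⟩, fun I J => ?_⟩
  · -- block row sum: `Σ_{y ∈ J} |T x y| ≤ e^{−κ|I−J|} Σ_y |T x y| e^{κ|I − blk y|} ≤ R e^{−κ|I−J|}`
    have hrow := hT x
    have hsub : ∑ y ∈ univ.filter (fun y : Fin n × Fin B => y.1 = J), |T x y| * siteWt n B κ x y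
        ≤ ∑ y, |T x y| * siteWt n B κ x y :=
      sum_le_sum_of_subset_of_nonneg (filter_subset _ _)
        fun y _ _ => mul_nonneg (abs_nonneg _) ((isWt_siteWt hκ0).nonneg x y)
    have hblk : ∑ y ∈ univ.filter (fun y : Fin n × Fin B => y.1 = J), |T x y| * siteWt n B κ x y
        = Real.exp (κ * bdist n x.1 J) * ∑ y ∈ univ.filter (fun y : Fin n × Fin B => y.1 = J), |T x y| := by
      rw [mul_sum]
      refine sum_congr rfl fun y hy => ?_
      rw [mem_filter] at hy
      rw [siteWt_apply, hy.2, mul_comm]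
    have hpos : 0 < Real.exp (κ * bdist n x.1 J) := Real.exp_pos _
    have hRe : R * Real.exp (-(κ * bdist n x.1 J)) ≤ max R 0 * Real.exp (-(κ * bdist n x.1 J)) :=
      mul_le_mul_of_nonneg_right (le_max_left _ _) (Real.exp_nonneg _)
    refine le_trans ?_ hRe
    rw [Real.exp_neg, ← div_eq_mul_inv, le_div_iff₀ hpos, mul_comm, ← hblk]
    exact hsub.trans hrow
  · simp only [toyFrame_ρ, toyFrame_sc, Frame.rate_zero, toyFrame_δ₀, id]
    have hmax : max R 0 ≤ c * (B : ℝ) ^ k := max_le hR (mul_nonneg hc (zpow_nonneg (Nat.cast_nonneg B) k))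
    rw [abs_of_nonneg (mul_nonneg (le_max_right _ _) (Real.exp_nonneg _))]
    calc max R 0 * Real.exp (-(κ * bdist n I J)) ≤ c * (B : ℝ) ^ k * Real.exp (-(κ * bdist n I J)) :=
          mul_le_mul_of_nonneg_right hmax (Real.exp_nonneg _)
      _ ≤ c * (B : ℝ) ^ k * Real.exp (-(δ₀ * bdist n I J)) := by
          refine mul_le_mul_of_nonneg_left (Real.exp_le_exp.mpr ?_)
            (mul_nonneg hc (zpow_nonneg (Nat.cast_nonneg B) k))
          nlinarith [bdist_nonneg (n := n) I J]

end Packaging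

section Lift

variable {n B : ℕ} {κ : ℝ}

/-- the COARSE LIFT `Q′ᵗ·M·Q′` of a block matrix to sites: entries `M(blk x, blk y)/B`. [folklore] -/
theorem coarseLift_apply (M : Matrix (Fin n) (Fin n) ℝ) (x y : Fin n × Fin B) :
    (Qpt n B * M * Qp n B) x y = (B : ℝ)⁻¹ * M x.1 y.1 := by
  simp only [Matrix.mul_apply, Qpt, Qp, ite_mul, one_mul, zero_mul, mul_ite, mul_zero, Finset.sum_ite_eq,
    Finset.mem_univ, if_true]
  ring

/-- the coarse lift PRESERVES the weighted row norm: `RowLe (ewt κ) M R ⇒ RowLe (siteWt κ) (Q′ᵗMQ′) R` (the `B` sites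
of a block against `Q′`'s `1/B`). [folklore] -/
theorem rowLe_coarseLift {M : Matrix (Fin n) (Fin n) ℝ} {R : ℝ} (hB : 0 < B) (hM : RowLe (ewt n κ) M R) :
    RowLe (siteWt n B κ) (Qpt n B * M * Qp n B) R := by
  intro x
  have hB' : (0 : ℝ) < B := by exact_mod_cast hB
  have e : ∑ y, |(Qpt n B * M * Qp n B) x y| * siteWt n B κ x y = ∑ J, |M x.1 J| * ewt n κ x.1 J := by
    rw [Fintype.sum_prod_type]
    refine sum_congr rfl fun J _ => ?_
    simp only [coarseLift_apply, siteWt_apply, ewt, abs_mul, abs_inv, Nat.abs_cast, sum_const, card_univ,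
      Fintype.card_fin, nsmul_eq_mul]
    field_simp
  rw [e]
  exact hM x.1

end Lift

/-! ## §4 The class of `Gtoy` -/

section GtoyClass

variable {n B : ℕ} {m l κ : ℝ}

/-- `Gtoy` as a product of five SQUARE fine factors: `G₀ + G₀·(∂G′)·(Q′ᵗM_C⁻¹Q′)·(G′∂*)·G₀`. [folklore] -/
theorem Gtoy_eq_prod (μ ν : ℝ) :
    Gtoy n B μ ν = G0 n B ν + G0 n B ν * (Dfw n B * Gr n B μ) * (Qpt n B * (MC n B μ ν)⁻¹ * Qp n B)
      * (Gr n B μ * Dbw n B) * G0 n B ν := by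
  unfold Gtoy; simp only [Matrix.mul_assoc]

/-- **THE BLOCK-WEIGHTED ROW NORM OF `Gtoy`** (symbolic): with `N(G₀) ≤ R₁(l)/2`, `N(∂G′), N(G′∂*) ≤ R_D(m)`,
`N(Q′ᵗM_C⁻¹Q′) ≤ R_M` one gets `N(G) ≤ R₁(l)/2 + (R₁(l)/2)·R_D(m)·R_M·R_D(m)·(R₁(l)/2)` — the `RowLe` algebra at the
FIXED weight, no rate loss. [folklore] -/
theorem rowLe_Gtoy (hm0 : 0 < m) (hm1 : m ≤ 1) (hl0 : 0 < l) (hl1 : l ≤ 1) (hκ : 0 ≤ κ) (hB : 0 < B)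
    (hsm : 0 < m / 4 - κ / B) (hsl : 0 < l / 2 - κ / B) {RM : ℝ} (hRM : 0 ≤ RM)
    (hMC : RowLe (ewt n κ) (MC n B (m ^ 2) (l ^ 2))⁻¹ RM) :
    RowLe (siteWt n B κ) (Gtoy n B (m ^ 2) (l ^ 2))
      (R1 B l κ / 2 + R1 B l κ / 2 * RD B m κ * RM * RD B m κ * (R1 B l κ / 2)) := by
  have hw := isWt_siteWt (n := n) (B := B) hκ
  have hG0 := rowLe_G0 (n := n) hl0 hl1 hκ hB hsl
  have hA := rowLe_DGr (n := n) hm0 hm1 hκ hB hsm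
  have hC := rowLe_GrD (n := n) hm0 hm1 hκ hB hsm
  have hL := rowLe_coarseLift hB hMC
  have hRD := RD_nonneg (B := B) hsm
  have hR1 : 0 ≤ R1 B l κ / 2 := by have := R1_pos (B := B) hl0 hsl; positivity
  rw [Gtoy_eq_prod]
  exact rowLe_add hw hG0
    (RowLe.mul hw (RowLe.mul hw (RowLe.mul hw (RowLe.mul hw hG0 hA hRD) hL hRM) hC hRD) hG0 hR1)

end GtoyClass

/-! ## §5 Numbers at `κ = 1/2`, `m = l = a/B` -/

section Numeric

variable {n B : ℕ} {N : Finset (Fin n)} {hN : N.Nonempty} {δ₀ a : ℝ}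

/-- `e^{1/4} ≤ 5/3`. [folklore] -/
theorem exp_fourth_le : Real.exp (1 / 4) ≤ 5 / 3 :=
  (Real.exp_le_exp.mpr (by norm_num)).trans exp_half_le

/-- the quarter rate: `a/B/4 − 1/2/B = (a−2)/B/4`. [folklore] -/
theorem qrate_eq (a : ℝ) (B : ℕ) : a / B / 4 - 1 / 2 / (B : ℝ) = (a - 2) / B / 4 := by ring

/-- the geometric factor of the quarter rate: `(1 − e^{−(a−2)/(4B)})⁻¹ ≤ 5B/(a−2)` for `2 < a ≤ B`. [folklore] -/
theorem geomfac_q_le (ha : 2 < a) (haB : a ≤ (B : ℝ)) :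
    (1 - Real.exp (-(a / B / 4 - 1 / 2 / (B : ℝ))))⁻¹ ≤ 5 * B / (a - 2) := by
  have hBr : (0 : ℝ) < B := by linarith
  have ha2 : 0 < a - 2 := by linarith
  rw [qrate_eq]
  calc (1 - Real.exp (-((a - 2) / B / 4)))⁻¹ ≤ 1 + ((a - 2) / B / 4)⁻¹ := inv_one_sub_exp_le (by positivity)
    _ = (a - 2 + 4 * B) / (a - 2) := by field_simp
    _ ≤ 5 * B / (a - 2) := div_le_div_of_nonneg_right (by linarith) ha2.le

/-- `R_D(a/B) ≤ 224·B/(a−2)` at `κ = 1/2`, `2 < a ≤ B`. [folklore] -/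
theorem RD_num_le (ha : 2 < a) (haB : a ≤ (B : ℝ)) : RD B (a / B) (1 / 2) ≤ 224 * B / (a - 2) := by
  have hBr : (0 : ℝ) < B := by linarith
  have ha2 : 0 < a - 2 := by linarith
  have hs : 0 < a / B / 4 - 1 / 2 / (B : ℝ) := by rw [qrate_eq]; positivity
  have h1 : 1 + Real.exp (-(a / B / 4 - 1 / 2 / (B : ℝ))) ≤ 2 := by
    have : Real.exp (-(a / B / 4 - 1 / 2 / (B : ℝ))) ≤ 1 := Real.exp_le_one_iff.mpr (by linarith)
    linarith
  have h2 := geomfac_q_le ha haB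
  have h3 : 0 ≤ (1 - Real.exp (-(a / B / 4 - 1 / 2 / (B : ℝ))))⁻¹ :=
    inv_nonneg.mpr (one_sub_exp_neg_pos hs).le
  unfold RD
  calc 8 * Real.exp (1 / 4) * Real.exp (1 / 2) * ((1 + Real.exp (-(a / B / 4 - 1 / 2 / (B : ℝ))))
        * (1 - Real.exp (-(a / B / 4 - 1 / 2 / (B : ℝ))))⁻¹)
      ≤ 8 * (5 / 3) * (5 / 3) * (2 * (5 * B / (a - 2))) :=
        mul_le_mul (mul_le_mul (mul_le_mul_of_nonneg_left exp_fourth_le (by norm_num)) exp_half_le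
          (by positivity) (by positivity)) (mul_le_mul h1 h2 h3 zero_le_two) (by positivity) (by positivity)
    _ = 2000 / 9 * B / (a - 2) := by ring
    _ ≤ 224 * B / (a - 2) := by
        rw [div_le_div_iff_of_pos_right ha2]; nlinarith

/-- **`G′((a/B)²) ∈ 𝒟(0, 2, 40/(a(a−1)))`** on the toy frame for `1 < a ≤ B`, `δ₀ ≤ 1/2` — the `mG'` SHAPE at mass
`a/B` (Toy5's `Gr_opDec` is the mass-`1/B` case). [folklore] -/
theorem Gr_opDec_num (ha : 1 < a) (haB : a ≤ (B : ℝ)) (hδ : δ₀ ≤ 1 / 2) :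
    OpDec (toyFrame n B N hN δ₀) Prod.fst Prod.fst id id 0 2 (40 / (a * (a - 1))) (Gr n B ((a / B) ^ 2)) := by
  have ha0 : 0 < a := by linarith
  have ha1 : 0 < a - 1 := by linarith
  have hBr : (0 : ℝ) < B := by linarith
  have hB : 0 < B := by exact_mod_cast hBr
  have hm1 : a / B ≤ 1 := by rw [div_le_one hBr]; exact haB
  have hs : 0 < a / B / 2 - 1 / 2 / (B : ℝ) := by rw [srate_eq]; positivity
  refine opDec_fine_of_rowLe (by norm_num) hδ (rowLe_Gr (by positivity) hm1 (by norm_num) hB hs)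
    (by positivity) ?_
  calc R1 B (a / B) (1 / 2) ≤ 40 * (B : ℝ) ^ 2 / (a * (a - 1)) := R1_num_le ha haB
    _ = 40 / (a * (a - 1)) * (B : ℝ) ^ (2 : ℤ) := by rw [zpow_ofNat]; ring

/-- **`G₀((a/B)²) = ½(∂∂* + (a/B)²)⁻¹ ∈ 𝒟(0, 2, 20/(a(a−1)))`** on the toy frame for `1 < a ≤ B`, `δ₀ ≤ 1/2`. [folklore] -/
theorem G0_opDec_num (ha : 1 < a) (haB : a ≤ (B : ℝ)) (hδ : δ₀ ≤ 1 / 2) :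
    OpDec (toyFrame n B N hN δ₀) Prod.fst Prod.fst id id 0 2 (20 / (a * (a - 1))) (G0 n B ((a / B) ^ 2)) := by
  have ha0 : 0 < a := by linarith
  have ha1 : 0 < a - 1 := by linarith
  have hBr : (0 : ℝ) < B := by linarith
  have hB : 0 < B := by exact_mod_cast hBr
  have hm1 : a / B ≤ 1 := by rw [div_le_one hBr]; exact haB
  have hs : 0 < a / B / 2 - 1 / 2 / (B : ℝ) := by rw [srate_eq]; positivity
  refine opDec_fine_of_rowLe (by norm_num) hδ (rowLe_G0 (by positivity) hm1 (by norm_num) hB hs)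
    (by positivity) ?_
  calc R1 B (a / B) (1 / 2) / 2 ≤ 40 * (B : ℝ) ^ 2 / (a * (a - 1)) / 2 :=
        div_le_div_of_nonneg_right (R1_num_le ha haB) zero_le_two
    _ = 20 / (a * (a - 1)) * (B : ℝ) ^ (2 : ℤ) := by rw [zpow_ofNat]; ring

/-- **`∂G′((a/B)²) ∈ 𝒟(0, 1, 224/(a−2))`** on the toy frame for `2 < a ≤ B`, `δ₀ ≤ 1/2` — the `mDG'` SHAPE at mass
`a/B` with an absolute constant (the general-mass gradient decay of §1). [folklore] -/
theorem DGr_opDec_num (ha : 2 < a) (haB : a ≤ (B : ℝ)) (hδ : δ₀ ≤ 1 / 2) :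
    OpDec (toyFrame n B N hN δ₀) Prod.fst Prod.fst id id 0 1 (224 / (a - 2))
      (Dfw n B * Gr n B ((a / B) ^ 2)) := by
  have ha0 : 0 < a := by linarith
  have ha2 : 0 < a - 2 := by linarith
  have hBr : (0 : ℝ) < B := by linarith
  have hB : 0 < B := by exact_mod_cast hBr
  have hm1 : a / B ≤ 1 := by rw [div_le_one hBr]; exact haB
  have hs : 0 < a / B / 4 - 1 / 2 / (B : ℝ) := by rw [qrate_eq]; positivity
  refine opDec_fine_of_rowLe (by norm_num) hδ (rowLe_DGr (by positivity) hm1 (by norm_num) hB hs)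
    (by positivity) ?_
  calc RD B (a / B) (1 / 2) ≤ 224 * B / (a - 2) := RD_num_le ha haB
    _ = 224 / (a - 2) * (B : ℝ) ^ (1 : ℤ) := by rw [zpow_ofNat]; ring

/-- the same for `G′∂*`. [folklore] -/
theorem GrD_opDec_num (ha : 2 < a) (haB : a ≤ (B : ℝ)) (hδ : δ₀ ≤ 1 / 2) :
    OpDec (toyFrame n B N hN δ₀) Prod.fst Prod.fst id id 0 1 (224 / (a - 2))
      (Gr n B ((a / B) ^ 2) * Dbw n B) := by
  have ha0 : 0 < a := by linarith
  have ha2 : 0 < a - 2 := by linarith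
  have hBr : (0 : ℝ) < B := by linarith
  have hB : 0 < B := by exact_mod_cast hBr
  have hm1 : a / B ≤ 1 := by rw [div_le_one hBr]; exact haB
  have hs : 0 < a / B / 4 - 1 / 2 / (B : ℝ) := by rw [qrate_eq]; positivity
  refine opDec_fine_of_rowLe (by norm_num) hδ (rowLe_GrD (by positivity) hm1 (by norm_num) hB hs)
    (by positivity) ?_
  calc RD B (a / B) (1 / 2) ≤ 224 * B / (a - 2) := RD_num_le ha haB
    _ = 224 / (a - 2) * (B : ℝ) ^ (1 : ℤ) := by rw [zpow_ofNat]; ring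

/-- the three factor sizes at `2²⁰ ≤ a ≤ B` in crude `a`-power form:
`R₁/2 ≤ 40B²/a²`, `R_D ≤ 448B/a`, `R_M = 4a⁶/(B⁴(a−6)²) ≤ 16a⁴/B⁴`. [folklore] -/
theorem factor_sizes (ha : 1048576 ≤ a) (haB : a ≤ (B : ℝ)) :
    R1 B (a / B) (1 / 2) / 2 ≤ 40 * (B : ℝ) ^ 2 / a ^ 2
      ∧ RD B (a / B) (1 / 2) ≤ 448 * B / a
      ∧ 4 * ((B : ℝ) ^ 4 * (a - 6) ^ 2 / a ^ 6)⁻¹ ≤ 16 * a ^ 4 / (B : ℝ) ^ 4 := by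
  have ha0 : 0 < a := by linarith
  have ha1 : 1 < a := by linarith
  have ha2 : 2 < a := by linarith
  have hBr : (0 : ℝ) < B := by linarith
  refine ⟨?_, ?_, ?_⟩
  · calc R1 B (a / B) (1 / 2) / 2 ≤ 40 * (B : ℝ) ^ 2 / (a * (a - 1)) / 2 :=
          div_le_div_of_nonneg_right (R1_num_le ha1 haB) zero_le_two
      _ ≤ 40 * (B : ℝ) ^ 2 / a ^ 2 := by
          rw [div_div, div_le_div_iff₀ (by nlinarith) (by positivity)]
          have hB2 : (0 : ℝ) ≤ (B : ℝ) ^ 2 := sq_nonneg _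
          nlinarith [mul_nonneg hB2 (by nlinarith : (0 : ℝ) ≤ a * (a - 2))]
  · calc RD B (a / B) (1 / 2) ≤ 224 * B / (a - 2) := RD_num_le ha2 haB
      _ ≤ 448 * B / a := by
          rw [div_le_div_iff₀ (by linarith) ha0]; nlinarith
  · have ha6 : 0 < a - 6 := by linarith
    rw [inv_div, ← mul_div_assoc, div_le_div_iff₀ (by positivity) (by positivity)]
    have h6 : a ^ 2 ≤ 4 * (a - 6) ^ 2 := by nlinarith
    have hB4 : (0 : ℝ) ≤ (B : ℝ) ^ 4 := by positivity
    have ha4 : (0 : ℝ) ≤ a ^ 4 := by positivity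
    calc 4 * a ^ 6 * (B : ℝ) ^ 4 = 4 * a ^ 2 * (a ^ 4 * (B : ℝ) ^ 4) := by ring
      _ ≤ 4 * (4 * (a - 6) ^ 2) * (a ^ 4 * (B : ℝ) ^ 4) :=
          mul_le_mul_of_nonneg_right (by linarith) (mul_nonneg ha4 hB4)
      _ = 16 * a ^ 4 * ((B : ℝ) ^ 4 * (a - 6) ^ 2) := by ring

/-- **THE ROW NORM OF `Gtoy` AT `m = l = a/B`, `κ = 1/2`**: `N(G) ≤ 10¹⁰·B²/a²` for `2²⁰ ≤ a ≤ B`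
(`40 + 40·448·16·448·40 = 5 138 022 440 ≤ 10¹⁰`). [folklore] -/
theorem rowLe_Gtoy_num (ha : 1048576 ≤ a) (haB : a ≤ (B : ℝ)) :
    RowLe (siteWt n B (1 / 2)) (Gtoy n B ((a / B) ^ 2) ((a / B) ^ 2)) (10 ^ 10 / a ^ 2 * (B : ℝ) ^ 2) := by
  have ha0 : 0 < a := by linarith
  have hBr : (0 : ℝ) < B := by linarith
  have hB : 0 < B := by exact_mod_cast hBr
  have hm0 : 0 < a / B := by positivity
  have hm1 : a / B ≤ 1 := by rwa [div_le_one hBr]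
  have hsm : 0 < a / B / 4 - 1 / 2 / (B : ℝ) := by rw [qrate_eq]; exact div_pos (div_pos (by linarith) hBr) four_pos
  have hsl : 0 < a / B / 2 - 1 / 2 / (B : ℝ) := by rw [srate_eq]; exact div_pos (div_pos (by linarith) hBr) two_pos
  obtain ⟨_, hMC⟩ := isUnit_MC_num (n := n) ha haB
  have hRM : 0 ≤ 4 * ((B : ℝ) ^ 4 * (a - 6) ^ 2 / a ^ 6)⁻¹ := by
    have : 0 ≤ (B : ℝ) ^ 4 * (a - 6) ^ 2 / a ^ 6 := by positivity
    positivity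
  have h := rowLe_Gtoy (n := n) hm0 hm1 hm0 hm1 (by norm_num) hB hsm hsl hRM hMC
  obtain ⟨hX, hY, hZ⟩ := factor_sizes ha haB
  have hX0 : 0 ≤ R1 B (a / B) (1 / 2) / 2 := by have := R1_pos (B := B) hm0 hsl; positivity
  have hY0 : 0 ≤ RD B (a / B) (1 / 2) := RD_nonneg hsm
  refine rowLe_mono h ?_
  calc R1 B (a / B) (1 / 2) / 2 + R1 B (a / B) (1 / 2) / 2 * RD B (a / B) (1 / 2)
          * (4 * ((B : ℝ) ^ 4 * (a - 6) ^ 2 / a ^ 6)⁻¹) * RD B (a / B) (1 / 2) * (R1 B (a / B) (1 / 2) / 2)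
      ≤ 40 * (B : ℝ) ^ 2 / a ^ 2
          + 40 * (B : ℝ) ^ 2 / a ^ 2 * (448 * B / a) * (16 * a ^ 4 / (B : ℝ) ^ 4) * (448 * B / a)
            * (40 * (B : ℝ) ^ 2 / a ^ 2) := by
        gcongr
    _ = (40 + 40 * 448 * 16 * 448 * 40) * (B : ℝ) ^ 2 / a ^ 2 := by field_simp
    _ ≤ 10 ^ 10 / a ^ 2 * (B : ℝ) ^ 2 := by
        rw [div_mul_eq_mul_div]
        exact div_le_div_of_nonneg_right (mul_le_mul_of_nonneg_right (by norm_num) (sq_nonneg _))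
          (by positivity)

/-- **`Gtoy((a/B)², (a/B)²) ∈ 𝒟(0, 2, 10¹⁰/a²)` ON THE TOY FRAME** for `2²⁰ ≤ a ≤ B`, `δ₀ ≤ 1/2` — the `MOne.mG`
SHAPE (`n = 0`, `k = 2`, constant free of `B`, `n`, `N`) inhabited by the Woodbury-assembled inverse of Toy8 with
`∂ ≠ 0` (B-power bookkeeping `2 + 1 − 4 + 1 + 2 = 2`). [folklore] -/
theorem Gtoy_opDec_num (ha : 1048576 ≤ a) (haB : a ≤ (B : ℝ)) (hδ : δ₀ ≤ 1 / 2) :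
    OpDec (toyFrame n B N hN δ₀) Prod.fst Prod.fst id id 0 2 (10 ^ 10 / a ^ 2)
      (Gtoy n B ((a / B) ^ 2) ((a / B) ^ 2)) := by
  have ha0 : 0 < a := by linarith
  refine opDec_fine_of_rowLe (by norm_num) hδ (rowLe_Gtoy_num ha haB) (by positivity) (le_of_eq ?_)
  rw [zpow_ofNat]

end Numeric

/-! ## §6 One constant for several slots: monotonicity of the class constant on the toy frame -/

section Mono

variable {n B : ℕ} {N : Finset (Fin n)} {hN : N.Nonempty} {δ₀ : ℝ}
variable {u v U V : Type*} [Fintype v] [DecidableEq V] {bu : u → U} {bv : v → V} {pU : U → Fin n} {pV : V → Fin n}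

/-- the class constant may be ENLARGED on the toy frame: `T ∈ 𝒟(nn, k, c)`, `0 ≤ c ≤ c′` give `T ∈ 𝒟(nn, k, c′)`
(`WDec.mono` at the toy frame's pseudodistance and nonnegative scale) — so the per-slot constants of this module
and of Toy7/Toy8 can be replaced by their maximum when ONE `c` is wanted (`MOne`). [folklore] -/
theorem opDec_toy_mono {nn : ℕ} {k : ℤ} {c c' : ℝ} {T : Matrix u v ℝ}
    (h : OpDec (toyFrame n B N hN δ₀) bu bv pU pV nn k c T) (hc0 : 0 ≤ c) (hc : c ≤ c') :
    OpDec (toyFrame n B N hN δ₀) bu bv pU pV nn k c' T := by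
  obtain ⟨K, hK, hW⟩ := h
  refine ⟨K, hK, hW.mono ?_ (fun I => ?_) hc0 hc le_rfl⟩
  · rw [toyFrame_ρ]; exact bdist_isPseudoDist n
  · rw [toyFrame_sc]; exact zpow_nonneg (Nat.cast_nonneg B) k

end Mono







end

end Literature.MathematicalPhysics.QuantumFieldTheory.Balaban1983to89.B9SectCDiffCutModelToy9
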